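import Summits.RiemannHypothesis.RiemannHypothesis.Theses.WeilComb
import Summits.RiemannHypothesis.RiemannHypothesis.Theorems.WeilCombCombShapePositivityWindowCoercivityRankTwo
import Summits.RiemannHypothesis.RiemannHypothesis.Theorems.WeilCombCombShapePositivityStubArchWindow
import Summits.RiemannHypothesis.RiemannHypothesis.Theorems.WeilCombCombShapePositivityExactPrimeWindow
import Summits.RiemannHypothesis.RiemannHypothesis.Theorems.WeilCombCombShapePositivityPolarExact
import Summits.RiemannHypothesis.RiemannHypothesis.Theorems.WeilCombCombShapePositivityPoleCoefficient
import Summits.RiemannHypothesis.RiemannHypothesis.Theorems.WeilCombCombSubcriticalStubIdentity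
import Literature.NumberTheory.LFunctions.WeilExplicit
import Literature.NumberTheory.LFunctions.WeilMellinBounds
import Literature.NumberTheory.LFunctions.WeilArchimedeanMoments
import Literature.Analysis.SpecialFunctions.DigammaVerticalSeries

/-!
# Theorem B reduced to the soft cone on a band: the energy normal form and the merge glue
(crux `WeilComb.CombShapePositivity`, item stmt-RiemannHypothesis-11229, line `Sketch`)

Notation. `φ₀(u) = expNegInvGlue (1 - u²)`, `φ_ε(t) = ε⁻¹ φ₀(t/ε)`, comb `g = Σ_{m ≤ M} a_m φ_ε(· − log m)`, `k = g ⋆ g̃`,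
`Q(g) = W(k)`, `N₀ = ‖φ₀‖₂²`, `U = ε⁻¹N₀`, `F_ε = ∫ φ₀(u) cosh(εu/2) du = φ̂_ε(0) = φ̂_ε(1)`, `L = Σ‖a_m‖²`,
`A₋ = Σ a_m (√m)⁻¹`, `A₊ = Σ a_m √m`, `ψ₁(y) = Σ_{n ≤ y} Λ(n)/n`, Dirichlet energy `D = Σ_m Σ_{n ≤ M/m} Λ(n)‖a(nm) − n^{-1/2}a(m)‖²`,
`ρ(u) = Re ψ(1/4 + iu/2)`, `archPlus(a) = (1/2π)∫|ĝ(1/2+iu)|²(ρ(u) − ρ(0))du`, coherence deficit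
`Δ(a) = (log M + 1 + log π − ρ(0))L − archPlus(a)/U`, rank-two pole constant `C₂ = (F_ε²ε/N₀)(√((1+log M)·M(M+1)/2) − M)`.

* `weilQuadratic_comb_re_window_energyForm` — the EXACT bookkeeping of Theorem B on the window `2ε(M+1) ≤ 1`, `M ≥ 1`:
  `Re Q(g) = 2F_ε² Re(A₋ conj A₊) − U·( Σ_m ‖a_m‖²(log m + ψ₁(M/m)) − D ) + archPlus(a) + (ρ(0) − log π)·U·L`
  (exact three-term identity p90904, polar p91841 + p92438, ground-state identity `WeilCombSubcritical.stub_identity`,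
  archimedean Plancherel form `stub_arch_window` p99537). Equivalently `Q/U + Δ = Re P/U + D + Σ_m (log M + 1 − log m − ψ₁(M/m))‖a_m‖²`.
* `window_of_subcritical_of_coneBand` — MERGE GLUE for the two decompositions of Theorem B in the crux chain: for ANY
  threshold `c₀`, an effective subcritical theorem (`εM ≤ c₀ ⇒ 0 ≤ Re Q`, e.g. lead -1's `stub_windowSub` with `c₀ = 1/128`)
  plus the exact window ON THE CONE `D ≤ Δ + C₂L` restricted to the band `c₀ < εM` give the whole window: off the cone
  the landed dichotomy `window_dichotomy_rank2` (p101483) closes the cell.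
-/

noncomputable section

-- the sub-problem path `RiemannHypothesis/RiemannHypothesis` (single-conjunct summit, D-0017) duplicates a namespace
set_option linter.dupNamespace false

open scoped BigOperators ComplexConjugate
open Complex MeasureTheory

namespace Summit.RiemannHypothesis.RiemannHypothesis.Theorems.WeilCombBohrFejer

open Literature.NumberTheory.LFunctions
open Literature.Analysis.SpecialFunctions (reDigammaQuarter)

/-- `Re(F · conj F · z) = F² Re z` for real `F` (the pole coefficient is a positive square). [folklore] -/
private theorem re_ofReal_conj_mul_windowRed (F : ℝ) (z : ℂ) :
    ((F : ℂ) * conj (F : ℂ) * z).re = F ^ 2 * z.re := by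
  rw [Complex.conj_ofReal, ← Complex.ofReal_mul, Complex.re_ofReal_mul]
  ring

/-- **Energy normal form of Theorem B on the exact window.** For `0 < ε`, `1 ≤ M`, `2ε(M+1) ≤ 1`:
`Re Q(g) = 2F_ε² Re(A₋ conj A₊) − ε⁻¹‖φ₀‖₂²·( Σ_m ‖a_m‖²(log m + ψ₁(M/m)) − D(a) ) + archPlus(a) + (ρ(0) − log π)·ε⁻¹‖φ₀‖₂²·Σ‖a_m‖²`.
[folklore] -/
theorem weilQuadratic_comb_re_window_energyForm : ∀ ε : ℝ, 0 < ε → ∀ (M : ℕ) (a : ℕ → ℂ), 1 ≤ M →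
    2 * ε * ((M : ℝ) + 1) ≤ 1 →
    (weilQuadratic (fun x : ℝ => ∑ m ∈ Finset.Icc 1 M,
        a m * ((ε : ℂ)⁻¹ * ((expNegInvGlue (1 - ((x - Real.log (m : ℝ)) / ε) ^ 2) : ℝ) : ℂ)))).re =
      2 * (∫ u : ℝ, expNegInvGlue (1 - u ^ 2) * Real.cosh (ε * u / 2)) ^ 2 *
          ((∑ m ∈ Finset.Icc 1 M, a m * ((Real.sqrt (m : ℝ) : ℝ) : ℂ)⁻¹) *
            conj (∑ m ∈ Finset.Icc 1 M, a m * ((Real.sqrt (m : ℝ) : ℝ) : ℂ))).re -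
        ε⁻¹ * weilNorm2Sq (fun u : ℝ => ((expNegInvGlue (1 - u ^ 2) : ℝ) : ℂ)) *
          ((∑ m ∈ Finset.Icc 1 M, ‖a m‖ ^ 2 *
              (Real.log m + ∑ n ∈ Finset.Icc 1 (M / m), (ArithmeticFunction.vonMangoldt n : ℝ) / n)) -
            ∑ m ∈ Finset.Icc 1 M, ∑ n ∈ Finset.Icc 1 (M / m),
              (ArithmeticFunction.vonMangoldt n : ℝ) * ‖a (n * m) - ((Real.sqrt n : ℂ))⁻¹ * a m‖ ^ 2) +
        (1 / (2 * Real.pi) * (∫ u : ℝ, ‖weilMellin (fun x : ℝ => ∑ m ∈ Finset.Icc 1 M,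
            a m * ((ε : ℂ)⁻¹ * ((expNegInvGlue (1 - ((x - Real.log (m : ℝ)) / ε) ^ 2) : ℝ) : ℂ)))
              (1 / 2 + u * I)‖ ^ 2 * (reDigammaQuarter u - reDigammaQuarter 0)) +
          (reDigammaQuarter 0 - Real.log Real.pi) *
            (ε⁻¹ * weilNorm2Sq (fun u : ℝ => ((expNegInvGlue (1 - u ^ 2) : ℝ) : ℂ)) *
              ∑ m ∈ Finset.Icc 1 M, ‖a m‖ ^ 2)) := by
  intro ε hε M a hM hw
  rw [weilQuadratic_comb_re_exactWindow ε hε M a hM hw, weilPolarTerm_comb_re ε hε M a,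
    stub_arch_window ε hε M a hw, WeilCombSubcritical.stub_identity M a]
  obtain ⟨hF0, hF1, -⟩ := weilMellin_dilBump_zero_one ε hε
  rw [hF0, hF1, re_ofReal_conj_mul_windowRed]
  ring

/-- **Merge glue: Theorem B from an effective subcritical window and the cone-restricted band.** For every threshold
`c₀`: if `εM ≤ c₀ ⇒ 0 ≤ Re Q(g)` (all `ε > 0`, `M`, `a`) and if on the band `c₀ < εM`, `2ε(M+1) ≤ 1`, `M ≥ 1` the cell holds
for every `a` IN the cone `D(a) ≤ Δ(a) + C₂‖a‖²`, then the whole exact window holds: `2ε(M+1) ≤ 1 ⇒ 0 ≤ Re Q(g)`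
(off the cone: `window_dichotomy_rank2`). [folklore] -/
theorem window_of_subcritical_of_coneBand : ∀ c₀ : ℝ,
    (∀ ε : ℝ, 0 < ε → ∀ (M : ℕ) (a : ℕ → ℂ), ε * M ≤ c₀ →
      0 ≤ (weilQuadratic (fun x : ℝ => ∑ m ∈ Finset.Icc 1 M,
        a m * ((ε : ℂ)⁻¹ * ((expNegInvGlue (1 - ((x - Real.log (m : ℝ)) / ε) ^ 2) : ℝ) : ℂ)))).re) →
    (∀ ε : ℝ, 0 < ε → ∀ (M : ℕ) (a : ℕ → ℂ), 1 ≤ M → c₀ < ε * M → 2 * ε * ((M : ℝ) + 1) ≤ 1 →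
      (∑ m ∈ Finset.Icc 1 M, ∑ n ∈ Finset.Icc 1 (M / m),
          (ArithmeticFunction.vonMangoldt n : ℝ) * ‖a (n * m) - ((Real.sqrt n : ℂ))⁻¹ * a m‖ ^ 2 ≤
        (Real.log M + 1 + Real.log Real.pi - reDigammaQuarter 0) * (∑ m ∈ Finset.Icc 1 M, ‖a m‖ ^ 2) -
            ε / weilNorm2Sq (fun u : ℝ => ((expNegInvGlue (1 - u ^ 2) : ℝ) : ℂ)) *
              (1 / (2 * Real.pi) * ∫ u : ℝ, ‖weilMellin (fun x : ℝ => ∑ m ∈ Finset.Icc 1 M,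
                a m * ((ε : ℂ)⁻¹ * ((expNegInvGlue (1 - ((x - Real.log (m : ℝ)) / ε) ^ 2) : ℝ) : ℂ)))
                  (1 / 2 + u * I)‖ ^ 2 * (reDigammaQuarter u - reDigammaQuarter 0)) +
          (∫ u : ℝ, expNegInvGlue (1 - u ^ 2) * Real.cosh (ε * u / 2)) ^ 2 * ε /
              weilNorm2Sq (fun u : ℝ => ((expNegInvGlue (1 - u ^ 2) : ℝ) : ℂ)) *
            (Real.sqrt ((1 + Real.log M) * ((M : ℝ) * ((M : ℝ) + 1) / 2)) - M) *
            (∑ m ∈ Finset.Icc 1 M, ‖a m‖ ^ 2)) →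
      0 ≤ (weilQuadratic (fun x : ℝ => ∑ m ∈ Finset.Icc 1 M,
        a m * ((ε : ℂ)⁻¹ * ((expNegInvGlue (1 - ((x - Real.log (m : ℝ)) / ε) ^ 2) : ℝ) : ℂ)))).re) →
    ∀ ε : ℝ, 0 < ε → ∀ (M : ℕ) (a : ℕ → ℂ), 2 * ε * ((M : ℝ) + 1) ≤ 1 →
      0 ≤ (weilQuadratic (fun x : ℝ => ∑ m ∈ Finset.Icc 1 M,
        a m * ((ε : ℂ)⁻¹ * ((expNegInvGlue (1 - ((x - Real.log (m : ℝ)) / ε) ^ 2) : ℝ) : ℂ)))).re := by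
  intro c₀ hsub hcone ε hε M a hw
  by_cases hlam : ε * M ≤ c₀
  · exact hsub ε hε M a hlam
  push Not at hlam
  rcases Nat.eq_zero_or_pos M with hM0 | hMpos
  · -- `M = 0`: zero comb, `Q(0) = 0`
    subst hM0
    have h0 : (fun x : ℝ => ∑ m ∈ Finset.Icc 1 0,
        a m * ((ε : ℂ)⁻¹ * ((expNegInvGlue (1 - ((x - Real.log (m : ℝ)) / ε) ^ 2) : ℝ) : ℂ))) = 0 := by
      funext x
      simp
    rw [h0, weilQuadratic_zero]
    simp
  have hM : 1 ≤ M := hMpos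
  have hC := hcone ε hε M a hM hlam hw
  have hD := window_dichotomy_rank2 ε hε M a hM hw
  rcases le_or_gt
      (∑ m ∈ Finset.Icc 1 M, ∑ n ∈ Finset.Icc 1 (M / m),
        (ArithmeticFunction.vonMangoldt n : ℝ) * ‖a (n * m) - ((Real.sqrt n : ℂ))⁻¹ * a m‖ ^ 2)
      ((Real.log M + 1 + Real.log Real.pi - reDigammaQuarter 0) * (∑ m ∈ Finset.Icc 1 M, ‖a m‖ ^ 2) -
          ε / weilNorm2Sq (fun u : ℝ => ((expNegInvGlue (1 - u ^ 2) : ℝ) : ℂ)) *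
            (1 / (2 * Real.pi) * ∫ u : ℝ, ‖weilMellin (fun x : ℝ => ∑ m ∈ Finset.Icc 1 M,
              a m * ((ε : ℂ)⁻¹ * ((expNegInvGlue (1 - ((x - Real.log (m : ℝ)) / ε) ^ 2) : ℝ) : ℂ)))
                (1 / 2 + u * I)‖ ^ 2 * (reDigammaQuarter u - reDigammaQuarter 0)) +
        (∫ u : ℝ, expNegInvGlue (1 - u ^ 2) * Real.cosh (ε * u / 2)) ^ 2 * ε /
            weilNorm2Sq (fun u : ℝ => ((expNegInvGlue (1 - u ^ 2) : ℝ) : ℂ)) *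
          (Real.sqrt ((1 + Real.log M) * ((M : ℝ) * ((M : ℝ) + 1) / 2)) - M) *
          (∑ m ∈ Finset.Icc 1 M, ‖a m‖ ^ 2)) with hin | hout
  · exact hC hin
  · exact hD hout

end Summit.RiemannHypothesis.RiemannHypothesis.Theorems.WeilCombBohrFejer

end
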